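import Summits.Ventures.WeilGRH.TwistedGramCellConsts
import HarnessLib

/-!
# GRH arm (rh-explicit, venture WeilGRH): the `A_op⁺` box from PROVED floors (cells at the integer points `2a/log p ∈ ℕ`)

Cell `rh-explicit`, WEIL TRACK — GRH ARM (engine seat weil-grh-2 gen9).  `TwistedGramCellConsts.mem_aopBox` needs the floors
`⌊2a/ℓ_i⌋` DECIDED on the interval boxes (`checkFloors`), which is impossible when `2a/ℓ_i` is an integer — e.g. the rung
`a = log 2 = (log 4)/2` of the census ladder, where `2a/log 2 = 2` exactly (so far such cells had to be certified at the wider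
window `18/25 ⊃ log 2`, which fails for the razor-thin real cells `3.2`, `4.3`, `5.4`).  This file decouples the two:

* `checkFloorAt` / `floor_eq_of_checkFloorAt` — the one-index version of `checkFloors` (decide the generic indices in the kernel);
* ★ `mem_aopBox_of_floors` — the conclusion of `mem_aopBox` from the floor facts `⌊2a/ℓ_i⌋₊ = n_i` supplied as HYPOTHESES
  (each proved either by `floor_eq_of_checkFloorAt` or by exact `Real.log` algebra);
* `floors_log_four_half` — the floor facts of the window `a = (log 4)/2`, primes `[2, 3]`: `⌊log 4/log 2⌋₊ = 2` (exact) and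
  `⌊log 4/log 3⌋₊ = 1` (`3 ≤ 4`, `2 < 3`), with `floors_of_checkFloorAt_cons` gluing a hand-proved head to kernel-checked tails.

Everything is PROVED; computable `def`s; no named facts; RH/GRH-free.  References: H. Yoshida (1992) §7
[Yoshida1992HermitianForms]; R. E. Moore (1966) Ch. 3 [Moore1966].
-/

set_option autoImplicit false

open Real Finset
open scoped BigOperators ArithmeticFunction.vonMangoldt

namespace Summit.Ventures.WeilGRH

open Literature.NumberTheory.LFunctions Literature.NumberTheory.LFunctions.Yoshida1992
open Literature.NumberTheory.LFunctions.Yoshida1992.Encl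
open Literature.Analysis.SpecialFunctions Literature.Analysis.ValidatedNumerics.NumericsMP

namespace TwistedEncl

variable {S : ℕ} {a : ℝ}

/-! ## One-index floor checker -/

/-- The floor `n_i = ⌊2a/ℓ_i⌋` decided on the boxes at ONE index `i`: `n_i·lens_i.hi ≤ 2·A.lo` and `2·A.hi < (n_i+1)·lens_i.lo`.
[cite: Moore1966, Ch. 3 (interval arithmetic: inclusion property)] -/
def checkFloorAt (C : Consts) (ns : List ℕ) (i : ℕ) : Bool :=
  decide (((ns.getD i 0 : ℕ) : ℤ) * (C.lens.getD i default).hi ≤ 2 * C.A.lo) &&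
    decide (2 * C.A.hi < (((ns.getD i 0 : ℕ) : ℤ) + 1) * (C.lens.getD i default).lo)

/-- The lengths `ℓ_i = e_i log p_i` of a prime-data window are positive. [folklore] -/
theorem PrimeData.len_pos {ks : List PrimeLen} (hks : PrimeData a ks) {i : ℕ} (hi : i < ks.length) :
    0 < (ks.getD i default).len := by
  have hmem : ks.getD i default ∈ ks := by
    rw [List.getD_eq_getElem _ _ hi]; exact List.getElem_mem hi
  obtain ⟨hp, he⟩ := hks.prime _ hmem
  unfold PrimeLen.len
  have : (1 : ℝ) < (ks.getD i default).p := by exact_mod_cast hp.one_lt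
  have := Real.log_pos this
  have he' : (0 : ℝ) < (ks.getD i default).e := by exact_mod_cast he
  positivity

/-- From the checked boxes at index `i`: `⌊2a/ℓ_i⌋₊ = n_i`. [cite: Moore1966, Ch. 3 (interval arithmetic: inclusion property)] -/
theorem floor_eq_of_checkFloorAt (hS : 0 < S) {ks : List PrimeLen} (hks : PrimeData a ks) {C : Consts}
    (hC : ConstsValid S a ks C) {ns : List ℕ} {i : ℕ} (hi : i < ks.length) (h : checkFloorAt C ns i = true) :
    ⌊2 * a / (ks.getD i default).len⌋₊ = ns.getD i 0 := by
  unfold checkFloorAt at h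
  simp only [Bool.and_eq_true, decide_eq_true_eq] at h
  obtain ⟨h1, h2⟩ := h
  have hℓ := hC.lens i hi
  have hA := hC.ha
  have hSr : (0 : ℝ) < S := by exact_mod_cast hS
  have hℓpos := PrimeData.len_pos hks hi
  set ℓ := (ks.getD i default).len with hℓdef
  set n := ns.getD i 0 with hndef
  have h1' : ((n : ℤ) : ℝ) * ((C.lens.getD i default).hi : ℝ) ≤ 2 * (C.A.lo : ℝ) := by exact_mod_cast h1
  have h2' : 2 * (C.A.hi : ℝ) < (((n : ℤ) : ℝ) + 1) * ((C.lens.getD i default).lo : ℝ) := by exact_mod_cast h2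
  have hlo : (n : ℝ) * ℓ ≤ 2 * a := by
    have e1 : (n : ℝ) * (ℓ * S) ≤ (n : ℝ) * (C.lens.getD i default).hi := mul_le_mul_of_nonneg_left hℓ.2 (by positivity)
    push_cast at h1'
    nlinarith [hA.1]
  have hhi : 2 * a < ((n : ℝ) + 1) * ℓ := by
    have e1 : ((n : ℝ) + 1) * (C.lens.getD i default).lo ≤ ((n : ℝ) + 1) * (ℓ * S) :=
      mul_le_mul_of_nonneg_left hℓ.1 (by positivity)
    push_cast at h2'
    nlinarith [hA.2]
  have h2a : 0 ≤ 2 * a := by nlinarith [hlo, hℓpos, (Nat.cast_nonneg n : (0 : ℝ) ≤ n)]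
  rw [Nat.floor_eq_iff (div_nonneg h2a hℓpos.le)]
  exact ⟨by rw [le_div_iff₀ hℓpos]; exact hlo, by rw [div_lt_iff₀ hℓpos]; exact hhi⟩

/-- Gluing: the floor fact at the head index `0` (proved by hand) and `checkFloorAt` on every index `≥ 1` give all the
floor facts. [cite: Moore1966, Ch. 3 (interval arithmetic: inclusion property)] -/
theorem floors_of_checkFloorAt_succ (hS : 0 < S) {ks : List PrimeLen} (hks : PrimeData a ks) {C : Consts}
    (hC : ConstsValid S a ks C) {ns : List ℕ} (h0 : 0 < ks.length → ⌊2 * a / (ks.getD 0 default).len⌋₊ = ns.getD 0 0)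
    (h : ((List.range (ks.length - 1)).all fun j ↦ checkFloorAt C ns (j + 1)) = true) :
    ∀ i < ks.length, ⌊2 * a / (ks.getD i default).len⌋₊ = ns.getD i 0 := by
  intro i hi
  rcases i with _ | j
  · exact h0 hi
  · simp only [List.all_eq_true, List.mem_range] at h
    exact floor_eq_of_checkFloorAt hS hks hC hi (h j (by omega))

/-! ## `AOP ∋ A_op⁺(a)` from floor facts -/

/-- ★ **Soundness of `aopBox` from PROVED floors**: if `⌊2a/ℓ_i⌋₊ = n_i` for every window index (hypotheses — by
`floor_eq_of_checkFloorAt`, or by exact `log` algebra at the integer points), then `A_op⁺(a) ∈ AOP`; literally the conclusion of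
`mem_aopBox`. [cite: Yoshida1992HermitianForms, §7 pp. 305–312] -/
theorem mem_aopBox_of_floors (hS : 0 < S) {ks : List PrimeLen} (hks : PrimeData a ks) {C : Consts}
    (hC : ConstsValid S a ks C) {K k : ℕ} {ns : List ℕ}
    (hfl : ∀ i < ks.length, ⌊2 * a / (ks.getD i default).len⌋₊ = ns.getD i 0) {AOP : MI}
    (h : aopBox S K k C ns = some AOP) :
    MI.mem S (∑ j ∈ weilPrimeIndex a, (Λ j : ℝ) / Real.sqrt j * (2 * Real.cos (π / (⌊2 * a / Real.log j⌋₊ + 2)))) AOP := by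
  have hsum : (∑ j ∈ weilPrimeIndex a, (Λ j : ℝ) / Real.sqrt j * (2 * Real.cos (π / (⌊2 * a / Real.log j⌋₊ + 2)))) =
      ∑ j ∈ Finset.range ks.length, (ks.getD j default).wt * (2 * Real.cos (π / ((ns.getD j 0 : ℕ) + 2))) := by
    rw [sum_weilPrimeIndex_eq_listSum hks (fun j ↦ 2 * Real.cos (π / (⌊2 * a / Real.log j⌋₊ + 2))),
      list_sum_map_eq_sum_range]
    refine Finset.sum_congr rfl fun j hj ↦ ?_
    rw [PrimeLen.log_val, hfl j (Finset.mem_range.mp hj)]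
  rw [hsum]
  unfold aopBox at h
  rw [hC.wts_len] at h
  exact mem_aopSum hS hC ns ks.length le_rfl h

/-! ## The integer point `a = (log 4)/2 = log 2` (rung `t = 4` of the census ladder), window primes `2, 3` -/

/-- `⌊log 4 / log 2⌋₊ = 2` — exact (`log 4 = 2 log 2`). [folklore] -/
theorem floor_log_four_div_log_two : ⌊2 * (Real.log 4 / 2) / ((1 : ℕ) * Real.log (2 : ℕ))⌋₊ = 2 := by
  have h2 : 0 < Real.log 2 := Real.log_pos (by norm_num)
  have h4 : Real.log 4 = 2 * Real.log 2 := by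
    rw [show (4 : ℝ) = 2 ^ 2 by norm_num, Real.log_pow]; push_cast; ring
  rw [show 2 * (Real.log 4 / 2) / ((1 : ℕ) * Real.log (2 : ℕ)) = 2 by
    push_cast; rw [h4]; field_simp]
  norm_num

/-- `⌊log 4 / log 3⌋₊ = 1` (`3 ≤ 4` and `4 < 9`). [folklore] -/
theorem floor_log_four_div_log_three : ⌊2 * (Real.log 4 / 2) / ((1 : ℕ) * Real.log (3 : ℕ))⌋₊ = 1 := by
  have h3 : 0 < Real.log 3 := Real.log_pos (by norm_num)
  have h34 : Real.log 3 ≤ Real.log 4 := Real.log_le_log (by norm_num) (by norm_num)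
  have h49 : Real.log 4 < 2 * Real.log 3 := by
    rw [show 2 * Real.log 3 = Real.log 9 by
      rw [show (9 : ℝ) = 3 ^ 2 by norm_num, Real.log_pow]; push_cast; ring]
    exact Real.log_lt_log (by norm_num) (by norm_num)
  rw [show 2 * (Real.log 4 / 2) / ((1 : ℕ) * Real.log (3 : ℕ)) = Real.log 4 / Real.log 3 by push_cast; ring]
  rw [Nat.floor_eq_iff (div_nonneg (h3.le.trans h34) h3.le)]
  push_cast
  exact ⟨by rw [le_div_iff₀ h3]; linarith, by rw [div_lt_iff₀ h3]; linarith⟩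

/-- The floor facts of the window `a = (log 4)/2`, primes `[2, 3]`: `ns = [2, 1]` — the hypothesis `hfl` of
`mem_aopBox_of_floors` for every cell at the rung `log 2`. [folklore] -/
theorem floors_log_four_half :
    ∀ i < ([⟨2, 1⟩, ⟨3, 1⟩] : List PrimeLen).length,
      ⌊2 * (Real.log 4 / 2) / (([⟨2, 1⟩, ⟨3, 1⟩] : List PrimeLen).getD i default).len⌋₊ = [2, 1].getD i 0 := by
  intro i hi
  have hi2 : i = 0 ∨ i = 1 := by simp at hi; omega
  rcases hi2 with rfl | rfl
  · exact floor_log_four_div_log_two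
  · exact floor_log_four_div_log_three

end TwistedEncl

end Summit.Ventures.WeilGRH
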